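import Mathlib
import Summits.QuantumFields.BalabanUV.Beta.FP.RepAlgebraTrace

/-!
# Road «FP» (binder row D1), REP∞ algebra layer — ALG-1: the bubble is BILINEAR and the tadpole LINEAR under superposed vertices

Continuation of `FP/RepAlgebra.lean` / `FP/RepAlgebraTrace.lean` (`HOME/b2b-balaban-beta-d1-p3/REP-DESIGN.md`, row ALG-1): for a
decaying `A`, stencil families `S u` bi-localised at their own index and weights `w` (the `ℋ`-column of the resolvent in
`AxialDressing.axVertexOfK`), the one-loop bubble and tadpole of `ExpKernelCalculus` expand over the superpositions
`OneStepResolventKernel.wsum w S`: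
* §5 rate weakening (`biLoc_of_rate_le`; for `Decays` use `DecayingKernelNeumann.decays_of_le`), **`bubble_wsum_right`**, **`bubble_comm`**, **`bubble_wsum_left`**, and **`bubble_wsum_wsum`**:
  `bubble A (wsum w S) (wsum w′ S′) = Σ'_u w u · Σ'_{u′} w′ u′ · bubble A (S u) (S′ u′)` (first weights exponentially localised,
  second bounded; common rate `δ > 0`);
* §6 **`tadpole_wsum`**: `tadpole A (wsum w T) = Σ'_u w u · tadpole A (T u)`.

Generic in the dimension `D` and the fibre `F`; [folklore] throughout; nothing about Bałaban's operators is asserted.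
HONEST FRAMING: bookkeeping toward `hident` (GAPS O-asym1-7); discharges nothing of `BetaPertH`; NOT the continuum limit, NOT Clay.
-/

noncomputable section

open Finset Filter Topology
open scoped BigOperators

namespace Summit.QuantumFields.BalabanUV.Beta.FP.RepAlgebraBubble

open Literature.MathematicalPhysics.QuantumFieldTheory.Balaban1983to89
open Literature.MathematicalPhysics.QuantumFieldTheory.Balaban1983to89.B12Sec2to5 (l1 l1_nonneg summable_exp_neg_l1)
open Literature.MathematicalPhysics.QuantumFieldTheory.Balaban1983to89.Beta.ExpKernelCalculus
open Literature.MathematicalPhysics.QuantumFieldTheory.Balaban1983to89.Beta.OneStepResolventKernel (wsum biLoc_wsum)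
open Summit.QuantumFields.BalabanUV.Beta.FP.RepAlgebra
open Summit.QuantumFields.BalabanUV.Beta.FP.RepAlgebraTrace

variable {D : ℕ} {F : Type*} [Fintype F]

/-! ## §5 (ALG-1) The bubble is linear in each vertex slot under superpositions; the tadpole likewise -/

section Bubble

variable {A : MKer D F} {C δ : ℝ}

omit [Fintype F] in
/-- [folklore] Weakening the rate of a bi-localisation bound. -/
theorem biLoc_of_rate_le {K : MKer D F} {p q : Site D} {CK δ δ' : ℝ} (hK : BiLoc K p q CK δ)
    (h1 : δ' ≤ δ) : BiLoc K p q CK δ' := by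
  intro x y a b
  refine (hK x y a b).trans (mul_le_mul_of_nonneg_left (Real.exp_le_exp.2 ?_) (hK.nonneg a))
  nlinarith [l1_nonneg (x - p), l1_nonneg (y - q)]

omit [Fintype F] in
/-- [folklore] Exponentially localised weights are bounded. -/
theorem abs_le_of_locWeight {w : Site D → ℝ} {p : Site D} {Cw δ : ℝ} (hw : ∀ u, |w u| ≤ Cw * Real.exp (-δ * l1 (u - p)))
    (hδ : 0 ≤ δ) (u : Site D) : |w u| ≤ Cw := by
  have hCw : 0 ≤ Cw := by
    have h := hw p
    rw [sub_self] at h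
    have : l1 (0 : Site D) = 0 := by simp [l1]
    rw [this, mul_zero, Real.exp_zero, mul_one] at h
    exact (abs_nonneg _).trans h
  refine (hw u).trans ?_
  have he : Real.exp (-δ * l1 (u - p)) ≤ 1 := by rw [Real.exp_le_one_iff]; nlinarith [l1_nonneg (u - p)]
  nlinarith

/-- [folklore] **Linearity of the bubble in its LAST slot under a superposition**: decaying `A`, `V` bi-localised at `(p,p)`,
stencils `S′ u′` bi-localised at `(u′,u′)` (common rate `δ > 0`), BOUNDED weights:
`bubble A V (wsum w′ S′) = Σ'_{u′} w′ u′ · bubble A V (S′ u′)`. -/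
theorem bubble_wsum_right (hA : Decays A C δ) (hδ : 0 < δ) {V : MKer D F} {p : Site D} {Cv : ℝ} (hV : BiLoc V p p Cv δ)
    {S' : Site D → MKer D F} {Cs : ℝ} (hS' : ∀ u', BiLoc (S' u') u' u' Cs δ) {w' : Site D → ℝ} {Cw' : ℝ}
    (hw' : ∀ u', |w' u'| ≤ Cw') :
    bubble A V (wsum w' S') = ∑' u', w' u' * bubble A V (S' u') := by
  have hδ2 : 0 < δ / 2 := half_pos hδ
  -- `comp A V` and the `comp A (S′ u′)` are bi-localised with rate `δ/2`
  have hAV : BiLoc (comp A V) p p ((Fintype.card F : ℝ) * (C * Cv) * Zl D (δ - δ / 2)) (δ / 2) :=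
    biLoc_comp_decays hA hV hδ2.le (by linarith)
  have hAS : ∀ u', BiLoc (comp A (S' u')) u' u' ((Fintype.card F : ℝ) * (C * Cs) * Zl D (δ - δ / 2)) (δ / 2) :=
    fun u' => biLoc_comp_decays hA (hS' u') hδ2.le (by linarith)
  unfold bubble
  -- step 1: `comp A (wsum w′ S′) = wsum w′ (u′ ↦ comp A (S′ u′))`
  rw [comp_wsum_right hA hδ hS' hδ hw']
  -- step 2: `comp (comp A V) (wsum w′ T′) = wsum w′ (u′ ↦ comp (comp A V) (T′ u′))` (`comp A V` decays at rate `δ/2`)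
  rw [comp_wsum_right (decays_of_biLoc_diag hAV hδ2.le) hδ2 hAS hδ2 hw']
  -- step 3: the trace passes through (`comp A V` bi-localised at `(p,p)`, the `T′ u′` at `(u′,u′)`, rate `δ/2`)
  exact tr_wsum_comp hAV hAS hδ2 hw'

/-- [folklore] **The bubble is symmetric in its two vertex slots** (cyclicity of the trace): `bubble A V W = bubble A W V`. -/
theorem bubble_comm (hA : Decays A C δ) (hδ : 0 < δ) {V W : MKer D F} {p q : Site D} {Cv Cw : ℝ}
    (hV : BiLoc V p p Cv δ) (hW : BiLoc W q q Cw δ) : bubble A V W = bubble A W V := by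
  have hδ2 : 0 < δ / 2 := half_pos hδ
  have hAV : BiLoc (comp A V) p p ((Fintype.card F : ℝ) * (C * Cv) * Zl D (δ - δ / 2)) (δ / 2) :=
    biLoc_comp_decays hA hV hδ2.le (by linarith)
  have hAW : BiLoc (comp A W) q q ((Fintype.card F : ℝ) * (C * Cw) * Zl D (δ - δ / 2)) (δ / 2) :=
    biLoc_comp_decays hA hW hδ2.le (by linarith)
  exact tr_comp_comm hAV hAW hδ2

/-- [folklore] **Linearity of the bubble in its FIRST slot under a superposition** (weights exponentially localised at `p`, so that
the superposed vertex is itself bi-localised — `OneStepResolventKernel.biLoc_wsum`):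
`bubble A (wsum w S) W = Σ'_u w u · bubble A (S u) W`. -/
theorem bubble_wsum_left (hA : Decays A C δ) (hδ : 0 < δ) {S : Site D → MKer D F} {Cs : ℝ}
    (hS : ∀ u, BiLoc (S u) u u Cs δ) {w : Site D → ℝ} {p : Site D} {Cw : ℝ} (hCw : 0 ≤ Cw)
    (hw : ∀ u, |w u| ≤ Cw * Real.exp (-δ * l1 (u - p))) {W : MKer D F} {q : Site D} {CW : ℝ} (hW : BiLoc W q q CW δ) :
    bubble A (wsum w S) W = ∑' u, w u * bubble A (S u) W := by
  have hδ2 : 0 < δ / 2 := half_pos hδ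
  -- everything at rate `δ/2`: the superposed vertex is bi-localised at `(p,p)` with rate `δ/2`
  have hV : BiLoc (wsum w S) p p (Cw * Cs * Zl D (δ / 2)) (δ / 2) := biLoc_wsum hw hS hδ hCw
  have hA2 : Decays A C (δ / 2) := fun x y a b =>
    (hA x y a b).trans (mul_le_mul_of_nonneg_left (Real.exp_le_exp.2 (by nlinarith [l1_nonneg (x - y)])) (hA.nonneg a))
  have hW2 : BiLoc W q q CW (δ / 2) := biLoc_of_rate_le hW (by linarith)
  have hS2 : ∀ u, BiLoc (S u) u u Cs (δ / 2) := fun u => biLoc_of_rate_le (hS u) (by linarith)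
  have hwb : ∀ u, |w u| ≤ Cw := fun u => abs_le_of_locWeight hw hδ.le u
  rw [bubble_comm hA2 hδ2 hV hW2, bubble_wsum_right hA2 hδ2 hW2 hS2 hwb]
  exact tsum_congr fun u => by rw [bubble_comm hA2 hδ2 hW2 (hS2 u)]

/-- [folklore] **ALG-1 — THE BUBBLE IS BILINEAR UNDER SUPERPOSED VERTICES**: decaying `A`, stencil families `S`, `S′` bi-localised
at their own index (common rate `δ > 0`), the first weight family exponentially localised (at `p`), the second bounded:
`bubble A (wsum w S) (wsum w′ S′) = Σ'_u w u · Σ'_{u′} w′ u′ · bubble A (S u) (S′ u′)`. -/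
theorem bubble_wsum_wsum (hA : Decays A C δ) (hδ : 0 < δ) {S S' : Site D → MKer D F} {Cs Cs' : ℝ}
    (hS : ∀ u, BiLoc (S u) u u Cs δ) (hS' : ∀ u', BiLoc (S' u') u' u' Cs' δ)
    {w w' : Site D → ℝ} {p : Site D} {Cw Cw' : ℝ} (hCw : 0 ≤ Cw) (hw : ∀ u, |w u| ≤ Cw * Real.exp (-δ * l1 (u - p)))
    (hw' : ∀ u', |w' u'| ≤ Cw') :
    bubble A (wsum w S) (wsum w' S') = ∑' u, w u * ∑' u', w' u' * bubble A (S u) (S' u') := by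
  have hδ2 : 0 < δ / 2 := half_pos hδ
  have hV : BiLoc (wsum w S) p p (Cw * Cs * Zl D (δ / 2)) (δ / 2) := biLoc_wsum hw hS hδ hCw
  have hA2 : Decays A C (δ / 2) := fun x y a b =>
    (hA x y a b).trans (mul_le_mul_of_nonneg_left (Real.exp_le_exp.2 (by nlinarith [l1_nonneg (x - y)])) (hA.nonneg a))
  have hS2 : ∀ u, BiLoc (S u) u u Cs (δ / 2) := fun u => biLoc_of_rate_le (hS u) (by linarith)
  have hS'2 : ∀ u', BiLoc (S' u') u' u' Cs' (δ / 2) := fun u' => biLoc_of_rate_le (hS' u') (by linarith)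
  -- last slot first (the superposed first vertex is bi-localised), then the first slot termwise
  rw [bubble_wsum_right hA2 hδ2 hV hS'2 hw']
  have e : ∀ u', bubble A (wsum w S) (S' u') = ∑' u, w u * bubble A (S u) (S' u') :=
    fun u' => bubble_wsum_left hA hδ hS hCw hw (hS' u')
  simp_rw [e]
  -- interchange the two absolutely convergent series: `Σ'_{u′} w′ u′ Σ'_u w u b(u,u′) = Σ'_u w u Σ'_{u′} w′ u′ b(u,u′)`
  classical
  rcases isEmpty_or_nonempty F with hF | ⟨⟨a₀⟩⟩
  · simp [bubble, tr, comp]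
  have hCw' : 0 ≤ Cw' := (abs_nonneg _).trans (hw' p)
  -- uniform exponential smallness of the elementary bubbles in `|u − u′|₁`
  set X0 : ℝ := (Fintype.card F : ℝ) * (C * Cs) * Zl D (δ - δ / 2) with hX0
  set X0' : ℝ := (Fintype.card F : ℝ) * (C * Cs') * Zl D (δ - δ / 2) with hX0'
  set Z4 : ℝ := Zl D (δ / 2 / 2) with hZ4
  set Kb : ℝ := (Fintype.card F : ℝ) * ((Fintype.card F : ℝ) * (X0 * X0') * Z4) * Z4 with hKbdef
  have hC : 0 ≤ C := hA.nonneg a₀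
  have hCs : 0 ≤ Cs := (hS p).nonneg a₀
  have hCs' : 0 ≤ Cs' := (hS' p).nonneg a₀
  have hZl1 : 0 ≤ Zl D (δ - δ / 2) := Zl_nonneg (by linarith)
  have hZ4nn : 0 ≤ Z4 := Zl_nonneg (by positivity)
  have hKb : 0 ≤ Kb := by rw [hKbdef]; positivity
  have hbub : ∀ u u', |bubble A (S u) (S' u')| ≤ Kb * Real.exp (-(δ / 2 / 2) * l1 (u - u')) := by
    intro u u'
    have h := abs_bubble_le hA (hS u) (hS' u') hδ
    set E : ℝ := Real.exp (-(δ / 2 / 2) * l1 (u - u')) with hE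
    have hE1 : E ≤ 1 := by rw [hE, Real.exp_le_one_iff]; nlinarith [l1_nonneg (u - u')]
    have hE0 : 0 ≤ E := Real.exp_nonneg _
    calc |bubble A (S u) (S' u')| ≤ _ := h
      _ = Kb * E * E := by rw [hKbdef, hX0, hX0', hZ4, hE]; ring
      _ ≤ Kb * E * 1 := by gcongr
      _ = Kb * E := mul_one _
  -- the double family and its product majorant
  set Φ : Site D → Site D → ℝ := fun u' u => w' u' * (w u * bubble A (S u) (S' u')) with hΦ
  have hΦb : ∀ u' u, |Φ u' u| ≤ (Cw' * (Cw * Kb)) *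
      (Real.exp (-(δ / 8) * l1 (u' - p)) * Real.exp (-(δ / 8) * l1 (u - p))) := by
    intro u' u
    rw [hΦ]; dsimp only
    rw [abs_mul, abs_mul]
    have htri : l1 (u' - p) ≤ l1 (u' - u) + l1 (u - p) := l1_sub_triangle u' u p
    have hsym : l1 (u' - u) = l1 (u - u') := l1_sub_symm u' u
    have hexp : Real.exp (-δ * l1 (u - p)) * Real.exp (-(δ / 2 / 2) * l1 (u - u'))
        ≤ Real.exp (-(δ / 8) * l1 (u' - p)) * Real.exp (-(δ / 8) * l1 (u - p)) := by
      rw [← Real.exp_add, ← Real.exp_add, Real.exp_le_exp]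
      nlinarith [l1_nonneg (u - p), l1_nonneg (u - u'), l1_nonneg (u' - p), hδ]
    calc |w' u'| * (|w u| * |bubble A (S u) (S' u')|)
        ≤ Cw' * ((Cw * Real.exp (-δ * l1 (u - p))) * (Kb * Real.exp (-(δ / 2 / 2) * l1 (u - u')))) :=
          mul_le_mul (hw' u') (mul_le_mul (hw u) (hbub u u') (abs_nonneg _) (by positivity)) (by positivity) hCw'
      _ = (Cw' * (Cw * Kb)) * (Real.exp (-δ * l1 (u - p)) * Real.exp (-(δ / 2 / 2) * l1 (u - u'))) := by ring
      _ ≤ (Cw' * (Cw * Kb)) * (Real.exp (-(δ / 8) * l1 (u' - p)) * Real.exp (-(δ / 8) * l1 (u - p))) :=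
          mul_le_mul_of_nonneg_left hexp (by positivity)
  have hδ8 : 0 < δ / 8 := by positivity
  have hsum : Summable (Function.uncurry Φ) := by
    have hprod : Summable fun vu : Site D × Site D =>
        Real.exp (-(δ / 8) * l1 (vu.1 - p)) * Real.exp (-(δ / 8) * l1 (vu.2 - p)) :=
      summable_mul_of_summable_norm (f := fun u' : Site D => Real.exp (-(δ / 8) * l1 (u' - p)))
        (g := fun u : Site D => Real.exp (-(δ / 8) * l1 (u - p)))
        (by simpa only [Real.norm_eq_abs, abs_of_nonneg (Real.exp_nonneg _)] using summable_exp_shift' hδ8 p)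
        (by simpa only [Real.norm_eq_abs, abs_of_nonneg (Real.exp_nonneg _)] using summable_exp_shift' hδ8 p)
    refine Summable.of_norm_bounded (hprod.mul_left (Cw' * (Cw * Kb))) fun vu => ?_
    rw [Real.norm_eq_abs]
    exact hΦb vu.1 vu.2
  have h1 : ∀ u', Summable (Φ u') := fun u' => hsum.prod_factor u'
  have h2 : ∀ u, Summable fun u' => Φ u' u := fun u => hsum.prod_symm.prod_factor u
  calc (∑' u', w' u' * ∑' u, w u * bubble A (S u) (S' u'))
      = ∑' u', ∑' u, Φ u' u := tsum_congr fun u' => by rw [hΦ]; exact (tsum_mul_left).symm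
    _ = ∑' u, ∑' u', Φ u' u := (hsum.tsum_comm' h1 h2).symm
    _ = ∑' u, w u * ∑' u', w' u' * bubble A (S u) (S' u') := tsum_congr fun u => by
        rw [← tsum_mul_left]
        exact tsum_congr fun u' => by rw [hΦ]; ring

end Bubble

/-! ## §6 The tadpole is linear under a superposed second-order vertex -/

section Tadpole

variable {A : MKer D F} {C δ : ℝ}

/-- [folklore] **Linearity of the tadpole under a superposition** (weights exponentially localised at `p`, stencils `T u`
bi-localised at `(u,u)`, common rate `δ > 0`): `tadpole A (wsum w T) = Σ'_u w u · tadpole A (T u)`. -/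
theorem tadpole_wsum (hA : Decays A C δ) (hδ : 0 < δ) {T : Site D → MKer D F} {CT : ℝ}
    (hT : ∀ u, BiLoc (T u) u u CT δ) {w : Site D → ℝ} {p : Site D} {Cw : ℝ} (hCw : 0 ≤ Cw)
    (hw : ∀ u, |w u| ≤ Cw * Real.exp (-δ * l1 (u - p))) :
    tadpole A (wsum w T) = ∑' u, w u * tadpole A (T u) := by
  classical
  have hwb : ∀ u, |w u| ≤ Cw := fun u => abs_le_of_locWeight hw hδ.le u
  unfold tadpole
  rw [comp_wsum_right hA hδ hT hδ hwb]
  rcases isEmpty_or_nonempty F with hF | ⟨⟨a₀⟩⟩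
  · simp [tr, comp, wsum]
  have hδ2 : 0 < δ / 2 := half_pos hδ
  have hC : 0 ≤ C := hA.nonneg a₀
  have hCT : 0 ≤ CT := (hT p).nonneg a₀
  -- `comp A (T u)` is bi-localised at `(u,u)` with rate `δ/2`
  set c₀ : ℝ := (Fintype.card F : ℝ) * (C * CT) * Zl D (δ - δ / 2) with hc₀
  have hc₀nn : 0 ≤ c₀ := by rw [hc₀]; have := Zl_nonneg (D := D) (show 0 < δ - δ / 2 by linarith); positivity
  have hK : ∀ u, BiLoc (comp A (T u)) u u c₀ (δ / 2) := fun u => biLoc_comp_decays hA (hT u) hδ2.le (by linarith)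
  refine tr_wsum (fun x a => ?_) ?_
  · -- entry series: `|w u · (A∘T u) x x a a| ≤ Cw e^{−δ|u−p|} · c₀`
    refine Summable.of_norm_bounded ((summable_exp_shift' hδ p).mul_left (Cw * c₀)) fun u => ?_
    rw [Real.norm_eq_abs, abs_mul]
    calc |w u| * |comp A (T u) x x a a| ≤ (Cw * Real.exp (-δ * l1 (u - p))) * c₀ :=
          mul_le_mul (hw u) (abs_le_of_biLoc (hK u) hδ2.le x x a a) (abs_nonneg _) (by positivity)
      _ = Cw * c₀ * Real.exp (-δ * l1 (u - p)) := by ring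
  · -- double family: `|w u · Σ_a (A∘T u) x x a a| ≤ Cw·|F|·c₀ · e^{−δ|u−p|} e^{−(δ/4)|x−u|} ≤ … e^{−(δ/8)|x−p|} e^{−(δ/8)|u−p|}`
    have hδ8 : 0 < δ / 8 := by positivity
    have hprod : Summable fun xu : Site D × Site D =>
        Real.exp (-(δ / 8) * l1 (xu.1 - p)) * Real.exp (-(δ / 8) * l1 (xu.2 - p)) :=
      summable_mul_of_summable_norm (f := fun x : Site D => Real.exp (-(δ / 8) * l1 (x - p)))
        (g := fun u : Site D => Real.exp (-(δ / 8) * l1 (u - p)))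
        (by simpa only [Real.norm_eq_abs, abs_of_nonneg (Real.exp_nonneg _)] using summable_exp_shift' hδ8 p)
        (by simpa only [Real.norm_eq_abs, abs_of_nonneg (Real.exp_nonneg _)] using summable_exp_shift' hδ8 p)
    refine Summable.of_norm_bounded (hprod.mul_left (Cw * ((Fintype.card F : ℝ) * c₀))) fun xu => ?_
    rw [Real.norm_eq_abs, abs_mul]
    have h1 := abs_trTerm_le (hK xu.2) hδ2.le xu.1
    -- `|Σ_a K x x a a| ≤ |F|·c₀·e^{0}·e^{−(δ/4)|x−u|}`
    have h2 : |∑ a, comp A (T xu.2) xu.1 xu.1 a a| ≤ (Fintype.card F : ℝ) * c₀ * Real.exp (-(δ / 2 / 2) * l1 (xu.1 - xu.2)) := by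
      refine h1.trans (le_of_eq ?_)
      rw [sub_self]
      have : l1 (0 : Site D) = 0 := by simp [l1]
      rw [this, mul_zero, Real.exp_zero, mul_one]
    have htri : l1 (xu.1 - p) ≤ l1 (xu.1 - xu.2) + l1 (xu.2 - p) := l1_sub_triangle xu.1 xu.2 p
    have hexp : Real.exp (-δ * l1 (xu.2 - p)) * Real.exp (-(δ / 2 / 2) * l1 (xu.1 - xu.2))
        ≤ Real.exp (-(δ / 8) * l1 (xu.1 - p)) * Real.exp (-(δ / 8) * l1 (xu.2 - p)) := by
      rw [← Real.exp_add, ← Real.exp_add, Real.exp_le_exp]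
      nlinarith [l1_nonneg (xu.2 - p), l1_nonneg (xu.1 - xu.2), l1_nonneg (xu.1 - p), hδ]
    calc |w xu.2| * |∑ a, comp A (T xu.2) xu.1 xu.1 a a|
        ≤ (Cw * Real.exp (-δ * l1 (xu.2 - p))) * ((Fintype.card F : ℝ) * c₀ * Real.exp (-(δ / 2 / 2) * l1 (xu.1 - xu.2))) :=
          mul_le_mul (hw xu.2) h2 (abs_nonneg _) (by positivity)
      _ = Cw * ((Fintype.card F : ℝ) * c₀) * (Real.exp (-δ * l1 (xu.2 - p)) * Real.exp (-(δ / 2 / 2) * l1 (xu.1 - xu.2))) := by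
          ring
      _ ≤ Cw * ((Fintype.card F : ℝ) * c₀) * (Real.exp (-(δ / 8) * l1 (xu.1 - p)) * Real.exp (-(δ / 8) * l1 (xu.2 - p))) :=
          mul_le_mul_of_nonneg_left hexp (by positivity)

end Tadpole

end Summit.QuantumFields.BalabanUV.Beta.FP.RepAlgebraBubble

end
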